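import Summits.QuantumFields.BalabanUV.T4Continuum.Support.NE7K1LinTorusResolventInverse
import Summits.QuantumFields.BalabanUV.T4Continuum.Support.NE7K1LinStripClassLineHolder
import Literature.MathematicalPhysics.QuantumFieldTheory.Balaban1983to89.B4Green242Bridge

/-!
# NE7K1LinTorusResolventDeriv — row NE7 (node U5), candidate route HOM, path H1L, cell K1-lin(s): NEEDS-ESTIMATE #E1, R-E1 —
# THE TORUS-SIDE DICTIONARY FOR THE SECOND QUANTITY OF (2.35) AND FOR (2.36) OVER THE CLASS `S`:
# `n·(K(z + e_μ) − K(z)) = torusKernelDS`, `(n∕|sv|_∞)^α·n·[(K(z+sv+e_μ) − K(z+sv)) − (K(z+e_μ) − K(z))] = torusKernelHS`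

Lineage `b2b-balaban-t4-ne7-p2` (CRUX PROVER NE7 #2), generation 77; file 78.  Files 69 ∕ 70 ∕ 71 ESTIMATE the torus kernels
`torusKernelDS n σ a τ μ N` and `torusKernelHS α n σ a τ μ sv N` of the differentiated and the Hölder-quotient (2.49) multipliers over the
class (`line_dtorusKernel_decay_torusMetric`, `line_htorusKernel_decay_torusMetric`), and file 76 docked the KERNEL `torusKernelS` to the
two-cutoff line's averaged resolvent `(T^𝕋(s) + aQ_n^*Q_n)⁻¹Q_n^*`.  What was not typed (HONEST line of files 69–71 and of the HANDOFF §
gen 76): that `torusKernelDS` ∕ `torusKernelHS` ARE the first ∕ weighted second fine-lattice DIFFERENCES of `torusKernelS` — b04 has this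
dictionary for the NN instance and the infinite-lattice kernel only (`B4Green242Bridge` §5–§6: `Gfull_add_e_sub`, `K_add_e_sub`,
`GDfull_add_sub`, `K_holder_dd`).  THIS FILE is that dictionary for EVERY symbol `σ` (no class hypothesis is needed: it is finite
Fourier algebra) and every period vector `N`:

* §1 THE FULL MULTIPLIERS over `σ` read at a fine point `z ∈ ℤ^{d}` (b04's `Gfull ∕ GDfull ∕ GHfull` with `R ↦ RS`, `E ↦ ES`):
  `GSfull`, `GDSfull`, `GHSfull`; `GSfull_finePt` (`= e^{iP·x⁰}·GS(τ; P)` at `z = n x⁰ + τ`), `GSfull_add_e_sub`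
  (`GSfull(z + e_μ) − GSfull(z) = n⁻¹·GDSfull(z; μ)`, b04's `PhZ_add_e`), `GDSfull_finePt`, `GDSfull_add_sub`
  (`GDSfull(z + sv) − GDSfull(z) = GHSfull(z; sv)`, b04's `PhZ_add`), `GHSfull_finePt`, `GHS_scaled_finePt`.
* §2 THE TORUS KERNELS AT FINE POINTS: `chiT_eq_cexp_phaseC` (the discrete-torus character IS the phase `e^{iθ(c)·x}` at the
  coarse-unit momentum `θ(c) = 2πc∕N`), and `torusKernelS_finePt` ∕ `torusKernelDS_finePt` ∕ `torusKernelHS_finePt`: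
  `torusKernelS n σ a τ N (x⁰ − β) = (Π N)⁻¹ Σ_k GSfull(n x⁰ + τ; θ(c_k))·χ_{c_k}(−β)` with file 61's centred grid representatives
  `c_k = cRep N k` (`rep_grid_eq`, `mFourier_gridPt_eq_chiT`, file 76's `chiT_cRepZ'`).
* §3 **THE DICTIONARY**: for every fine point `z = n x⁰ + τ`, reading `z + e_μ` and `z + sv (+ e_μ)` through `coarse ∕ offset`:
  **`torusKernelS_step`** `n·(TK(z + e_μ) − TK(z)) = torusKernelDS n σ a τ μ N (x⁰ − β)` and **`torusKernelS_holder`**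
  `(n∕|sv|_∞)^α·n·[(TK(z+sv+e_μ) − TK(z+sv)) − (TK(z+e_μ) − TK(z))] = torusKernelHS α n σ a τ μ sv N (x⁰ − β)`, where
  `TK(w) := torusKernelS n σ a (offset n w) N (coarse n w − β)` is the torus kernel read at the fine point `w`.
  With file 76 these say: the first ∕ weighted second fine differences (in the FIRST argument) of the kernel of
  `(T^𝕋(s) + aQ_n^*Q_n)⁻¹Q_n^*` are files 71's objects, so `line_dtorusKernel_decay_torusMetric` ∕ `line_htorusKernel_decay_torusMetric`
  ARE (2.35)'s second quantity ∕ (2.36) for the line's averaged resolvent on the torus (away from the wrap of the representative box;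
  the Neumann-box version, where no wrap occurs, is file 79).

HONEST FRAMING: [folklore]; finite Fourier bookkeeping, b04's §5–§6 re-run with one symbol letter generalised; no estimate; nothing of
Bałaban's asserted; no `sorry`.  Census only (#E1's (o3): the dictionary the box layer's second ∕ third quantities consume); NE7 NOT
PRINTED ∕ NOT PROVED; spine 0∕9; FIXED FINITE T⁴, rung (B)+1; NOT infinite volume, NOT mass gap, NOT Clay.  HONEST DEPENDENCY: continuum
YM on T⁴ ⇐ BetaPertH ∧ nine spine estimates (0/9 proved); BetaPertH ⇐ (D1) ∧ (D4) ∧ CAP+tail; G-an2-4 gates asym, D1 and NE2/3/4.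
-/

noncomputable section

open Finset Complex UnitAddTorus

namespace Summit.QuantumFields.BalabanUV.T4Continuum.NE7K1LinTorusResolventDeriv

open Literature.MathematicalPhysics.QuantumFieldTheory.Balaban1983to89
open Literature.MathematicalPhysics.QuantumFieldTheory.Balaban1983to89.B4Strip
open Literature.MathematicalPhysics.QuantumFieldTheory.Balaban1983to89.B4StripSums
open Literature.MathematicalPhysics.QuantumFieldTheory.Balaban1983to89.B4StripSumsDeriv (D)
open Literature.MathematicalPhysics.QuantumFieldTheory.Balaban1983to89.B4StripSumsHolder (PhZ efZ)
open Literature.MathematicalPhysics.QuantumFieldTheory.Balaban1983to89.B4ContourShift (supNorm)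
open Literature.MathematicalPhysics.QuantumFieldTheory.Balaban1983to89.B4Green244 (finePt coarse offset coarse_finePt
  finePt_coarse_offset e phaseC V PhZ_finePt PhZ_add_e)
open Literature.MathematicalPhysics.QuantumFieldTheory.Balaban1983to89.B4Green242Bridge (PhZ_add)
open Literature.MathematicalPhysics.QuantumFieldTheory.Balaban1983to89.B4TorusKernel (rep)
open Literature.MathematicalPhysics.QuantumFieldTheory.Balaban1983to89.B4TorusKernel.MultiPeriod (gridPt)
open Literature.MathematicalPhysics.QuantumFieldTheory.Balaban1983to89.B4Reflection242 (boxDom)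
open NE7K1LinStripClass NE7K1LinStripClassSums NE7K1LinStripClassSumsDeriv NE7K1LinStripClassSumsHolder
open NE7K1LinStripClassLineDecay NE7K1LinStripClassLineHolder
open NE7K1LinTorusLineSymbol NE7K1LinTorusFineWaves NE7K1LinTorusLineEngine NE7K1LinTorusResolventInverse

open scoped Real

variable {d : ℕ}

/-! ### §1 The full multipliers over the class, read at a fine point -/

section Full

/-- THE FULL MULTIPLIER over `σ` read at the fine point `z`: `GSfull(z; P) = Σ_k e^{i(P+2πk)·z∕n} V(k;P) RS_k(P)∕ES(P)` (b04's `Gfull`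
with `R ↦ RS`, `E ↦ ES`). [folklore] -/
def GSfull (n : ℕ) [NeZero n] (σ : (Fin d → ℂ) → ℂ) (a : ℝ) (z : Fin d → ℤ) (P : Fin d → ℂ) : ℂ :=
  ∑ k : Fin d → Fin n, PhZ n k z P * V n k P * RS n σ k P / ES n σ a P

/-- THE DIFFERENTIATED FULL MULTIPLIER over `σ`: the `k`-th term of `GSfull` times `D_n(k_μ; P_μ) = n(e^{i(P_μ+2πk_μ)∕n} − 1)`
(b04's `GDfull` with `R ↦ RS`, `E ↦ ES`). [folklore] -/
def GDSfull (n : ℕ) [NeZero n] (σ : (Fin d → ℂ) → ℂ) (a : ℝ) (z : Fin d → ℤ) (μ : Fin d) (P : Fin d → ℂ) : ℂ :=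
  ∑ k : Fin d → Fin n, D n (k μ : ℕ) (P μ) * (PhZ n k z P * V n k P * RS n σ k P / ES n σ a P)

/-- THE HÖLDER-DIFFERENCE FULL MULTIPLIER over `σ` (fine displacement `sv`, without the weight): the `k`-th term of `GDSfull` times
`e^{i(P+2πk)·sv∕n} − 1` (b04's `GHfull` with `R ↦ RS`, `E ↦ ES`). [folklore] -/
def GHSfull (n : ℕ) [NeZero n] (σ : (Fin d → ℂ) → ℂ) (a : ℝ) (z : Fin d → ℤ) (μ : Fin d) (sv : Fin d → ℤ)
    (P : Fin d → ℂ) : ℂ :=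
  ∑ k : Fin d → Fin n, (PhZ n k sv P - 1) * (D n (k μ : ℕ) (P μ) * (PhZ n k z P * V n k P * RS n σ k P / ES n σ a P))

/-- `GSfull(n x⁰ + τ; P) = e^{iP·x⁰}·GS n σ a τ P`. [folklore] -/
theorem GSfull_finePt (n : ℕ) [NeZero n] (σ : (Fin d → ℂ) → ℂ) (a : ℝ) (x : Fin d → ℤ) (j : Fin d → Fin n)
    (P : Fin d → ℂ) : GSfull n σ a (finePt n x j) P = cexp (I * phaseC P x) * GS n σ a j P := by
  unfold GSfull GS termS F V
  rw [Finset.mul_sum]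
  refine Finset.sum_congr rfl fun k _ => ?_
  rw [PhZ_finePt n (NeZero.ne n), mul_assoc (cexp _), ← Finset.prod_mul_distrib]
  ring

/-- the forward fine step: `GSfull(z + e_μ) − GSfull(z) = n⁻¹·GDSfull(z; μ)` (`e^{i(P+2πk)_μ∕n} − 1 = n⁻¹D_n(k_μ;P_μ)`). [folklore] -/
theorem GSfull_add_e_sub (n : ℕ) [NeZero n] (σ : (Fin d → ℂ) → ℂ) (a : ℝ) (z : Fin d → ℤ) (μ : Fin d) (P : Fin d → ℂ) :
    GSfull n σ a (z + e μ) P - GSfull n σ a z P = ((n : ℂ))⁻¹ * GDSfull n σ a z μ P := by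
  unfold GSfull GDSfull
  rw [Finset.mul_sum, ← Finset.sum_sub_distrib]
  refine Finset.sum_congr rfl fun k _ => ?_
  rw [PhZ_add_e]
  unfold D
  have hn : (n : ℂ) ≠ 0 := Nat.cast_ne_zero.mpr (NeZero.ne n)
  rw [show I * (P μ + 2 * π * ((k μ : ℕ) : ℂ)) / n = I * ((P μ + 2 * π * ((k μ : ℕ) : ℂ)) / n) by rw [mul_div_assoc]]
  field_simp

/-- `GDSfull(n x⁰ + τ; μ; P) = e^{iP·x⁰}·GDS n σ a τ μ P`. [folklore] -/
theorem GDSfull_finePt (n : ℕ) [NeZero n] (σ : (Fin d → ℂ) → ℂ) (a : ℝ) (x : Fin d → ℤ) (j : Fin d → Fin n) (μ : Fin d)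
    (P : Fin d → ℂ) : GDSfull n σ a (finePt n x j) μ P = cexp (I * phaseC P x) * GDS n σ a j μ P := by
  unfold GDSfull GDS termDS termS F V
  rw [Finset.mul_sum]
  refine Finset.sum_congr rfl fun k _ => ?_
  rw [PhZ_finePt n (NeZero.ne n), mul_assoc (cexp _), ← Finset.prod_mul_distrib]
  ring

/-- `GDSfull(z + sv; μ) − GDSfull(z; μ) = GHSfull(z; μ; sv)`. [folklore] -/
theorem GDSfull_add_sub (n : ℕ) [NeZero n] (σ : (Fin d → ℂ) → ℂ) (a : ℝ) (z sv : Fin d → ℤ) (μ : Fin d) (P : Fin d → ℂ) :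
    GDSfull n σ a (z + sv) μ P - GDSfull n σ a z μ P = GHSfull n σ a z μ sv P := by
  unfold GDSfull GHSfull
  rw [← Finset.sum_sub_distrib]
  refine Finset.sum_congr rfl fun k _ => ?_
  rw [PhZ_add]
  ring

/-- `GHSfull(n x⁰ + τ; μ; sv; P) = e^{iP·x⁰}·Σ_k termHS n σ a τ μ sv k P`. [folklore] -/
theorem GHSfull_finePt (n : ℕ) [NeZero n] (σ : (Fin d → ℂ) → ℂ) (a : ℝ) (x : Fin d → ℤ) (j : Fin d → Fin n) (μ : Fin d)
    (sv : Fin d → ℤ) (P : Fin d → ℂ) :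
    GHSfull n σ a (finePt n x j) μ sv P = cexp (I * phaseC P x) * ∑ k : Fin d → Fin n, termHS n σ a j μ sv k P := by
  unfold GHSfull termHS termDS termS F V
  rw [Finset.mul_sum]
  refine Finset.sum_congr rfl fun k _ => ?_
  rw [PhZ_finePt n (NeZero.ne n), mul_assoc (cexp _), ← Finset.prod_mul_distrib]
  ring

/-- with the Hölder weight (dimension `d + 1`): `(n∕|sv|_∞)^α·GHSfull(n x⁰ + τ; μ; sv; P) = e^{iP·x⁰}·GHS α n σ a τ μ sv P`. [folklore] -/
theorem GHS_scaled_finePt (α : ℝ) (n : ℕ) [NeZero n] (σ : (Fin (d + 1) → ℂ) → ℂ) (a : ℝ) (x : Fin (d + 1) → ℤ)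
    (j : Fin (d + 1) → Fin n) (μ : Fin (d + 1)) (sv : Fin (d + 1) → ℤ) (P : Fin (d + 1) → ℂ) :
    ((((n : ℝ) / supNorm sv) ^ α : ℝ) : ℂ) * GHSfull n σ a (finePt n x j) μ sv P =
      cexp (I * phaseC P x) * GHS α n σ a j μ sv P := by
  rw [GHSfull_finePt]
  unfold GHS
  ring

end Full

/-! ### §2 The torus kernels at fine points -/

section Torus

/-- the discrete-torus character IS the phase at the coarse-unit momentum: `χ_c(x) = e^{iθ(c)·x}`, `θ(c)_μ = 2πc_μ∕N_μ`. [folklore] -/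
theorem chiT_eq_cexp_phaseC (N : Fin (d + 1) → ℕ) (c x : Fin (d + 1) → ℤ) :
    chiT N c x = cexp (I * phaseC (ofRealVec (thetaOf N c)) x) := by
  unfold chiT phaseC ofRealVec thetaOf
  congr 1
  rw [Finset.sum_mul, Finset.mul_sum]
  refine Finset.sum_congr rfl fun μ _ => ?_
  push_cast
  ring

variable {n : ℕ} [NeZero n] {N : Fin (d + 1) → ℕ}

/-- the engine's grid momentum is `θ` of file 61's centred representative (as a complex vector). [folklore] -/
theorem gridMom_eq_thetaOf (hN : ∀ i, 1 ≤ N i) (k : (i : Fin (d + 1)) → Fin (N i)) :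
    ofRealVec (fun i => 2 * Real.pi * rep (gridPt N k i)) = ofRealVec (thetaOf N (cRep N k)) := by
  unfold ofRealVec
  funext i
  show ((2 * Real.pi * rep (gridPt N k i) : ℝ) : ℂ) = _
  rw [rep_grid_eq hN k i]

/-- the grid character splits: `Π_μ e^{2πi(x−β)_μk_μ∕N_μ} = e^{iθ(c_k)·x}·χ_{c_k}(−β)`. [folklore] -/
theorem mFourier_gridPt_sub (hN : ∀ i, 1 ≤ N i) (k : (i : Fin (d + 1)) → Fin (N i)) (x β : Fin (d + 1) → ℤ) :
    mFourier (x - β) (gridPt N k) = cexp (I * phaseC (ofRealVec (thetaOf N (cRep N k))) x) * chiT N (cRep N k) (-β) := by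
  rw [mFourier_gridPt_eq_chiT hN, ← chiT_cRepZ' hN, sub_eq_add_neg, chiT_add, chiT_eq_cexp_phaseC]

/-- **THE TORUS KERNEL AT A FINE POINT**: `torusKernelS n σ a τ N (x⁰ − β) = (Π N)⁻¹ Σ_k GSfull(n x⁰ + τ; θ(c_k))·χ_{c_k}(−β)`. [folklore] -/
theorem torusKernelS_finePt (hN : ∀ i, 1 ≤ N i) (σ : (Fin (d + 1) → ℂ) → ℂ) (a : ℝ) (x₀ : Fin (d + 1) → ℤ)
    (τ : Fin (d + 1) → Fin n) (β : Fin (d + 1) → ℤ) :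
    torusKernelS n σ a τ N (x₀ - β) = (∏ i, ((N i : ℕ) : ℂ))⁻¹ * ∑ k : (i : Fin (d + 1)) → Fin (N i),
      GSfull n σ a (finePt n x₀ τ) (ofRealVec (thetaOf N (cRep N k))) * chiT N (cRep N k) (-β) := by
  unfold torusKernelS
  refine congrArg (fun t => (∏ i, ((N i : ℕ) : ℂ))⁻¹ * t) (Finset.sum_congr rfl fun k _ => ?_)
  rw [gridMom_eq_thetaOf hN, mFourier_gridPt_sub hN, GSfull_finePt]
  ring

/-- the differentiated torus kernel at a fine point: `torusKernelDS n σ a τ μ N (x⁰ − β) = (Π N)⁻¹ Σ_k GDSfull(n x⁰ + τ; μ; θ(c_k))·χ_{c_k}(−β)`.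
[folklore] -/
theorem torusKernelDS_finePt (hN : ∀ i, 1 ≤ N i) (σ : (Fin (d + 1) → ℂ) → ℂ) (a : ℝ) (x₀ : Fin (d + 1) → ℤ)
    (τ : Fin (d + 1) → Fin n) (μ : Fin (d + 1)) (β : Fin (d + 1) → ℤ) :
    torusKernelDS n σ a τ μ N (x₀ - β) = (∏ i, ((N i : ℕ) : ℂ))⁻¹ * ∑ k : (i : Fin (d + 1)) → Fin (N i),
      GDSfull n σ a (finePt n x₀ τ) μ (ofRealVec (thetaOf N (cRep N k))) * chiT N (cRep N k) (-β) := by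
  unfold torusKernelDS
  refine congrArg (fun t => (∏ i, ((N i : ℕ) : ℂ))⁻¹ * t) (Finset.sum_congr rfl fun k _ => ?_)
  rw [gridMom_eq_thetaOf hN, mFourier_gridPt_sub hN, GDSfull_finePt]
  ring

/-- the Hölder torus kernel at a fine point:
`torusKernelHS α n σ a τ μ sv N (x⁰ − β) = (Π N)⁻¹ Σ_k (n∕|sv|_∞)^α·GHSfull(n x⁰ + τ; μ; sv; θ(c_k))·χ_{c_k}(−β)`. [folklore] -/
theorem torusKernelHS_finePt (hN : ∀ i, 1 ≤ N i) (α : ℝ) (σ : (Fin (d + 1) → ℂ) → ℂ) (a : ℝ) (x₀ : Fin (d + 1) → ℤ)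
    (τ : Fin (d + 1) → Fin n) (μ : Fin (d + 1)) (sv β : Fin (d + 1) → ℤ) :
    torusKernelHS α n σ a τ μ sv N (x₀ - β) = (∏ i, ((N i : ℕ) : ℂ))⁻¹ * ∑ k : (i : Fin (d + 1)) → Fin (N i),
      ((((n : ℝ) / supNorm sv) ^ α : ℝ) : ℂ) * GHSfull n σ a (finePt n x₀ τ) μ sv (ofRealVec (thetaOf N (cRep N k))) *
        chiT N (cRep N k) (-β) := by
  unfold torusKernelHS
  refine congrArg (fun t => (∏ i, ((N i : ℕ) : ℂ))⁻¹ * t) (Finset.sum_congr rfl fun k _ => ?_)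
  rw [gridMom_eq_thetaOf hN, mFourier_gridPt_sub hN, GHS_scaled_finePt]
  ring

end Torus

/-! ### §3 The dictionary: fine differences of the torus kernel in the first argument -/

section Dictionary

variable {n : ℕ} [NeZero n] {N : Fin (d + 1) → ℕ}

/-- **THE FIRST DIFFERENCE**: for a fine point `z = n x⁰ + τ` and its neighbour `z + e_μ` (read through `coarse ∕ offset`),
`n·(torusKernelS n σ a (offset (z+e_μ)) N (coarse (z+e_μ) − β) − torusKernelS n σ a τ N (x⁰ − β)) = torusKernelDS n σ a τ μ N (x⁰ − β)`
— files 69 ∕ 71's differentiated torus kernel IS `∂^ξ_μ` (forward difference, `ξ = 1∕n`) of file 68's torus kernel in its first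
argument. [folklore] -/
theorem torusKernelS_step (hN : ∀ i, 1 ≤ N i) (σ : (Fin (d + 1) → ℂ) → ℂ) (a : ℝ) (x₀ : Fin (d + 1) → ℤ)
    (τ : Fin (d + 1) → Fin n) (μ : Fin (d + 1)) (β : Fin (d + 1) → ℤ) :
    (n : ℂ) * (torusKernelS n σ a (offset n (finePt n x₀ τ + e μ)) N (coarse n (finePt n x₀ τ + e μ) - β) -
        torusKernelS n σ a τ N (x₀ - β)) = torusKernelDS n σ a τ μ N (x₀ - β) := by
  have hn : (n : ℂ) ≠ 0 := Nat.cast_ne_zero.mpr (NeZero.ne n)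
  rw [torusKernelS_finePt hN, torusKernelS_finePt hN, torusKernelDS_finePt hN, finePt_coarse_offset, ← mul_sub,
    ← Finset.sum_sub_distrib, ← mul_assoc, mul_comm (n : ℂ), mul_assoc, Finset.mul_sum]
  refine congrArg (fun t => (∏ i, ((N i : ℕ) : ℂ))⁻¹ * t) (Finset.sum_congr rfl fun k _ => ?_)
  rw [← sub_mul, GSfull_add_e_sub, ← mul_assoc, ← mul_assoc, mul_inv_cancel₀ hn, one_mul]

/-- **THE WEIGHTED SECOND DIFFERENCE**: for a fine base point `z = n x⁰ + τ`, a fine displacement `sv` and a direction `μ` (the four points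
`z`, `z + e_μ`, `z + sv`, `z + sv + e_μ` read through `coarse ∕ offset`),
`(n∕|sv|_∞)^α · n · [(TK(z+sv+e_μ) − TK(z+sv)) − (TK(z+e_μ) − TK(z))] = torusKernelHS α n σ a τ μ sv N (x⁰ − β)`,
`TK(w) := torusKernelS n σ a (offset w) N (coarse w − β)` — files 70 ∕ 71's Hölder torus kernel IS the weighted difference of
`∂^ξ_μ` of file 68's torus kernel between the fine points `z + sv` and `z`. [folklore] -/
theorem torusKernelS_holder (hN : ∀ i, 1 ≤ N i) (α : ℝ) (σ : (Fin (d + 1) → ℂ) → ℂ) (a : ℝ) (x₀ : Fin (d + 1) → ℤ)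
    (τ : Fin (d + 1) → Fin n) (μ : Fin (d + 1)) (sv β : Fin (d + 1) → ℤ) :
    ((((n : ℝ) / supNorm sv) ^ α : ℝ) : ℂ) * ((n : ℂ) *
      ((torusKernelS n σ a (offset n (finePt n x₀ τ + sv + e μ)) N (coarse n (finePt n x₀ τ + sv + e μ) - β) -
          torusKernelS n σ a (offset n (finePt n x₀ τ + sv)) N (coarse n (finePt n x₀ τ + sv) - β)) -
        (torusKernelS n σ a (offset n (finePt n x₀ τ + e μ)) N (coarse n (finePt n x₀ τ + e μ) - β) -
          torusKernelS n σ a τ N (x₀ - β)))) = torusKernelHS α n σ a τ μ sv N (x₀ - β) := by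
  have hn : (n : ℂ) ≠ 0 := Nat.cast_ne_zero.mpr (NeZero.ne n)
  -- the two first differences are differentiated kernels at the base points `z + sv` and `z`
  have h1 := torusKernelS_step hN σ a (coarse n (finePt n x₀ τ + sv)) (offset n (finePt n x₀ τ + sv)) μ β
  rw [finePt_coarse_offset] at h1
  have h0 := torusKernelS_step hN σ a x₀ τ μ β
  rw [mul_sub (n : ℂ), h1, h0, torusKernelDS_finePt hN, torusKernelDS_finePt hN, torusKernelHS_finePt hN, finePt_coarse_offset,
    ← mul_sub, ← Finset.sum_sub_distrib, ← mul_assoc, mul_comm (((((n : ℝ) / supNorm sv) ^ α : ℝ) : ℂ)), mul_assoc, Finset.mul_sum]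
  refine congrArg (fun t => (∏ i, ((N i : ℕ) : ℂ))⁻¹ * t) (Finset.sum_congr rfl fun k _ => ?_)
  rw [← sub_mul, GDSfull_add_sub, ← mul_assoc]

end Dictionary

end Summit.QuantumFields.BalabanUV.T4Continuum.NE7K1LinTorusResolventDeriv

end
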